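import Summits.ResolutionOfSingularities.ResolutionOfSingularities.Theorems.CuspCutCells2
import Summits.ResolutionOfSingularities.ResolutionOfSingularities.Theorems.ForcedTowerClasses
import Literature.AlgebraicGeometry.Resolution.HironakaTauTransport
import Literature.AlgebraicGeometry.Resolution.DiffIdealStalk
import Literature.AlgebraicGeometry.Resolution.DiffIdealSupportOrder
import Literature.AlgebraicGeometry.Resolution.SharpOrderCoordinateCentre
import Literature.AlgebraicGeometry.Resolution.TangentDirections
import Literature.AlgebraicGeometry.Resolution.RegularBlowup
import Literature.AlgebraicGeometry.Resolution.RegularCentreBlowupOrder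
import Literature.AlgebraicGeometry.Resolution.BlowupReducedDimension
import Literature.AlgebraicGeometry.Resolution.SubschemeRegularStalks
import Literature.AlgebraicGeometry.Resolution.BoundarySplitting
import Literature.AlgebraicGeometry.Resolution.PermissibleCentres
import Literature.AlgebraicGeometry.Resolution.BlowupOffCentre
import Literature.AlgebraicGeometry.Resolution.BlowupSequencesRestrictMarked
import Literature.AlgebraicGeometry.Resolution.BlowupsFlatBaseChange
import Literature.AlgebraicGeometry.Resolution.BlowupSequencesAppend
import HarnessLib

/-!
# ExitCutKernels — decomp-res node «ExitCut» (lens-2 g27, critic row 212 CLEARED · MAP +1 ONCE (port layer 1)), tree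
file 1/3 of the node

Content VERBATIM from the decomp-res lens-2 g27 node `HOME/decomp-res-lens-2/g27/ExitCut.lean` (pin a67800dc = PIN
STATUS :1844, 673 l; HOME = run/shared/lean/pub/decomp-res): NO carry — the node imports the LANDED tree only
(`Theorems.MaxContactCutCuspCut` = the g24 node «CuspCut», `Theorems.ForcedTowerClasses`, fifteen
`Literature.AlgebraicGeometry.Resolution.*` modules, `HarnessLib`); every declaration is new; namespace
`…Theses.ExitCut` ↦ `…Theorems.ExitCut` (same renaming as CuspCut / FaceCut; decl names kept; the node's
dupNamespace-linter line — needed only under the Theses-style namespace — dropped).  Farm (node; lens + critic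
runs): rc 0 · 0 err · 0 warn · 0 sorry; axioms std (propext / Classical.choice / Quot.sound) on `oneShotPort_holds`
/ `orderOneContact_holds` / `genericRung_of_faceFormExit` / `closes` /
`componentPackagePort_of_multiUnitPackageTransport`; no `native_decide`, no `allowUnsafeReducibility`.  Critic:
CRITIC-LEDGER row 212 (l.279) «ExitCut» CLEARED, MAP +1 ONCE (port layer 1) — (e1)–(e8) met, tree currency: THE
ONE-CENTRE EXIT MECHANISM IN KERNEL — **`oneShotPort_holds (n) : FaceFormCutClasses.OneShotPort n` for EVERY `n`**,
hypothesis-free (maximal contact read on the stalk `isContactPt_iff_not_le_sq` / `isContactPt_iff_exists_stalk`;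
transport of maximal contact off the centre of a blow-up `isContactPt_controlledTransform_of_not_mem`; the one-shot
centre through ALL exit points at once `exitLocus` / `exitCentre` (regular, permissible); class transport
`classGE_controlledTransform_of_not_mem` / `classGE_controlledTransform_exitCentre`; concatenation
`weakResolution_cons`), `oneShotPort_holds'` (the `∀ n ≥ 2` binder shape), **`orderOneContact_holds :
OrderOneContact`** (0-weight hygiene) — `OneShotPort` was carried as a HYPOTHESIS (COSTUME (M)) by every lens-2
wiring since g9 and is now DISCHARGED IN KERNEL; by-name corollaries through the landed consumers with the binders
`hport : OneShotPort n` / `h1 : OrderOneContact` REMOVED (`genericRung_of_faceFormExit`,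
`genRungAt_of_faceFormExit`, `genRungAt_one_holds`, `l/d/pGenRungAt_one_holds`, `cuspGenericRung_of_ports`,
`closes_of_engines`, `closes`); the PORT RESIDUAL typed (0-weight): **`MultiUnitPackageTransport n`** [UNDECIDED ·
NOT claimed] with `componentPackagePort_of_multiUnitPackageTransport : MultiUnitPackageTransport n → SeqDimFour 2 n
→ ComponentPackagePort n` and `multiUnit_conclusion_of_exitPts` (the one-centre layer = the case «all units are
isolated exit points»); `weakAdmissible_append_iff`, `weakResolution_append`.  Landing orders = the lens LANDING
NOTE INBOX :1437 endorsed by the critic rider INBOX 2026-08-31T11:18:17Z: (X1) `ExitCutKernels` = §K.1–§K.4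
(sections `Contact` / `Transport` / `Port` / `Step`), (X2) `ExitCutKernels2` = §K.5 `Kernel` + §K.7 `Residual`
(cone-free; home of the typed port residual), (X3) `MaxContactCutExitCut` = §K.6 `Corollaries` (the only
declarations touching the `Theses.MaxContactCut` wiring; imports X2 + the landed `MaxContactCutCuspCut`); X1/X2
import the node's imports with the cone wiring file replaced by its cone-free part `CuspCutCells2` (so no cone-free
file reaches `Theses`); all VERBATIM, `--kind proof --supports stmt-ResolutionOfSingularities-29273`; NO aside
switch (33866 `LeafSpecialRung` unchanged); `bc/Probe.lean` stays HOME.  The one `def … : Prop`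
(`MultiUnitPackageTransport`) is THIS node's typed residual letter (cn26) — not a vendored fact; `kStr`,
`exitLocus`, `exitCentre` … are data-valued definitions.

## This file

§K.1 `section Contact` — MAXIMAL CONTACT READ ON THE STALK: `kStr`, `isContactPt_iff_not_le_sq`,
`exists_section_germ_mem_not_mem_sq`, `isContactPt_iff_exists_stalk`, `isContactPt_one`; §K.2 `section Transport` —
transport of maximal contact OFF the centre of a blow-up: `isContactPt_controlledTransform_of_not_mem` (+
companions); §K.3 `section Port` — THE ONE-SHOT CENTRE through all exit points at once: `exitLocus` / `exitCentre`
(+ `_finite`, regularity, permissibility, support lemmas); §K.4 `section Step` — generic one-step lemmas for any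
centre: `classGE_controlledTransform_of_not_mem`, `weakResolution_cons`.

[WRITER NOTE (decomp-res writer g13): file split only (tree files ≤ 400 lines); sections, section `variable`s /
`open`s and every declaration exactly as in the lens (namespace renamed Theses ↦ Theorems, the HOME-only
dupNamespace-linter line dropped; `noncomputable section` and the five file-level `open` lines replayed in every file).]

(Sources: Hironaka1964 Ch. III §§1–3, §7; Giraud1975; CossartJannsenSaito2020 Ch. 2, Ch. 8–9; EGAIV4 §16–§17;
Matsumura1987 §28–§30; CossartPiltant2008 Prop. 4.2; BierstoneMilman1997 §3; Cutkosky2004 Ch. 6–7; Kollar2007 §3;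
StacksProject 01WV / 0806 / 080A.)
-/

noncomputable section

open CategoryTheory AlgebraicGeometry IsLocalRing TopologicalSpace Topology
open Literature.AlgebraicGeometry.Resolution
open Summit.ResolutionOfSingularities.ResolutionOfSingularities.Theorems
open Summit.ResolutionOfSingularities.ResolutionOfSingularities.Theorems.WeakOrderReduction
open Summit.ResolutionOfSingularities.ResolutionOfSingularities.Theorems.FaceFormCutClasses

namespace Summit.ResolutionOfSingularities.ResolutionOfSingularities.Theorems.ExitCut

section Contact

variable {k : Type} [Field k] {Y : Scheme.{0}} (g : Y ⟶ Spec (.of k))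

/-! ## §K.1  Maximal contact read on the stalk -/

/-- The `k`-structure `k → Γ(Y, 𝒪_Y)` of a `k`-variety `g : Y → Spec k` (the one `IsContactPt` uses). -/
abbrev kStr : k →+* Γ(Y, ⊤) := g.appTop.hom.comp (Scheme.ΓSpecIso (.of k)).inv.hom

/-- **Maximal contact is a property of the stalk `Diff^{≤ n-1}(𝓘)_y`:** at a point of order `≥ n ≥ 1`,
`y` is a maximal-contact point of `(𝓘, n)` iff `Diff^{≤ n-1}(𝓘)_y ⊄ 𝔪_y²`. [folklore] -/
theorem isContactPt_iff_not_le_sq [LocallyOfFiniteType g] (I : Y.IdealSheafData) {n : ℕ} {y : Y}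
    (hn : 1 ≤ n) (hy : ((n : ℕ) : ℕ∞) ≤ idealOrder I y) :
    IsContactPt g I n y ↔
      ¬ stalkIdeal (diffIdealSheaf (kStr g) (n - 1) I) y ≤ maximalIdeal (Y.presheaf.stalk y) ^ 2 := by
  constructor
  · rintro ⟨U, hyU, u, huJ, -, hu2⟩ hle
    apply hu2
    apply hle
    rw [stalkIdeal_eq_map_germ _ U hyU]
    exact Ideal.mem_map_of_mem _ huJ
  · intro hJ2
    have hft : HasFiniteTypeSections (kStr g) := hasFiniteTypeSections_of_locallyOfFiniteType k g
    obtain ⟨U', hU', hyU', -⟩ :=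
      exists_isAffineOpen_mem_and_subset (X := Y) (x := y) (U := ⊤) (Opens.mem_top y)
    obtain ⟨u, huJ, hu2⟩ := exists_section_germ_not_mem_sq _ hJ2 ⟨U', hU'⟩ hyU'
    have hyJ : y ∈ (diffIdealSheaf (kStr g) (n - 1) I).support := by
      apply mem_support_diffIdealSheaf_of_le_idealOrder hft I
      rwa [Nat.sub_add_cancel hn]
    refine ⟨⟨U', hU'⟩, hyU', u, huJ, ?_, hu2⟩
    apply (mem_support_iff_stalkIdeal_le _ y).mp hyJ
    rw [stalkIdeal_eq_map_germ _ (⟨U', hU'⟩ : Y.affineOpens) hyU']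
    exact Ideal.mem_map_of_mem _ huJ

/-- From a stalk element of `J_x` lying in `𝔪_x ∖ 𝔪_x²` to a SECTION of `J` over any affine
neighbourhood with the same property (if `J_x ⊆ 𝔪_x` use `exists_section_germ_not_mem_sq`; otherwise some
section of `J` is a unit at `x`, and one multiplies it by a numerator of the given element — the stalk is
the localisation `IsAffineOpen.isLocalization_stalk`). [folklore] -/
theorem exists_section_germ_mem_not_mem_sq {X : Scheme.{0}} (J : X.IdealSheafData) {x : X}
    {z : X.presheaf.stalk x} (hzJ : z ∈ stalkIdeal J x) (hz1 : z ∈ maximalIdeal (X.presheaf.stalk x))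
    (hz2 : z ∉ maximalIdeal (X.presheaf.stalk x) ^ 2) (U : X.affineOpens) (hxU : x ∈ (U : X.Opens)) :
    ∃ s ∈ J.ideal U, (X.presheaf.germ U x hxU).hom s ∈ maximalIdeal (X.presheaf.stalk x) ∧
      (X.presheaf.germ U x hxU).hom s ∉ maximalIdeal (X.presheaf.stalk x) ^ 2 := by
  by_cases hle : stalkIdeal J x ≤ maximalIdeal (X.presheaf.stalk x)
  · obtain ⟨s, hs, hs2⟩ := exists_section_germ_not_mem_sq J (fun h => hz2 (h hzJ)) U hxU
    refine ⟨s, hs, hle ?_, hs2⟩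
    rw [stalkIdeal_eq_map_germ J U hxU]
    exact Ideal.mem_map_of_mem _ hs
  · obtain ⟨s₁, hs₁, hs₁u⟩ :
        ∃ s₁ ∈ J.ideal U, (X.presheaf.germ U x hxU).hom s₁ ∉ maximalIdeal (X.presheaf.stalk x) := by
      by_contra h
      push Not at h
      apply hle
      rw [stalkIdeal_eq_map_germ J U hxU, Ideal.map_le_iff_le_comap]
      exact fun s hs => h s hs
    letI := X.presheaf.algebra_section_stalk (⟨x, hxU⟩ : (U : X.Opens))
    haveI := U.2.isLocalization_stalk ⟨x, hxU⟩
    obtain ⟨⟨a, t⟩, hat⟩ := IsLocalization.surj (U.2.primeIdealOf ⟨x, hxU⟩).asIdeal.primeCompl z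
    have ht : IsUnit ((X.presheaf.germ U x hxU).hom t) := IsLocalization.map_units (X.presheaf.stalk x) t
    have hat' : z * (X.presheaf.germ U x hxU).hom t = (X.presheaf.germ U x hxU).hom a := hat
    have hs₁' : IsUnit ((X.presheaf.germ U x hxU).hom s₁) := by
      by_contra hns; exact hs₁u ((IsLocalRing.mem_maximalIdeal _).mpr hns)
    have hu : IsUnit ((X.presheaf.germ U x hxU).hom t * (X.presheaf.germ U x hxU).hom s₁) := ht.mul hs₁'
    refine ⟨a * s₁, Ideal.mul_mem_left _ a hs₁, ?_, ?_⟩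
    · rw [map_mul, ← hat', mul_assoc]
      exact Ideal.mul_mem_right _ _ hz1
    · rw [map_mul, ← hat', mul_assoc]
      intro hmem
      exact hz2 ((Ideal.mul_unit_mem_iff_mem _ hu).mp hmem)

/-- **Maximal contact read on the stalk, order-free form:** `y` is a maximal-contact point of `(𝓘, n)`
iff some element of the stalk `Diff^{≤ n-1}(𝓘)_y` lies in `𝔪_y ∖ 𝔪_y²`. [folklore] -/
theorem isContactPt_iff_exists_stalk (I : Y.IdealSheafData) {n : ℕ} {y : Y} :
    IsContactPt g I n y ↔ ∃ z ∈ stalkIdeal (diffIdealSheaf (kStr g) (n - 1) I) y,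
      z ∈ maximalIdeal (Y.presheaf.stalk y) ∧ z ∉ maximalIdeal (Y.presheaf.stalk y) ^ 2 := by
  constructor
  · rintro ⟨U, hyU, u, huJ, hum, hu2⟩
    refine ⟨_, ?_, hum, hu2⟩
    rw [stalkIdeal_eq_map_germ _ U hyU]
    exact Ideal.mem_map_of_mem _ huJ
  · rintro ⟨z, hzJ, hz1, hz2⟩
    obtain ⟨U', hU', hyU', -⟩ :=
      exists_isAffineOpen_mem_and_subset (X := Y) (x := y) (U := ⊤) (Opens.mem_top y)
    obtain ⟨u, huJ, hum, hu2⟩ := exists_section_germ_mem_not_mem_sq _ hzJ hz1 hz2 ⟨U', hU'⟩ hyU'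
    exact ⟨⟨U', hU'⟩, hyU', u, huJ, hum, hu2⟩

/-- **Order one is maximal contact** (kernel `OrderOneContact`, hypothesis-free): at a point with
`ord_y 𝓘 = 1` some germ of `𝓘_y ⊆ Diff^{≤ 0}(𝓘)_y` lies in `𝔪_y ∖ 𝔪_y²`. [folklore] -/
theorem isContactPt_one [LocallyOfFiniteType g] (I : Y.IdealSheafData) {y : Y}
    (hy : idealOrder I y = ((1 : ℕ) : ℕ∞)) : IsContactPt g I 1 y := by
  rw [isContactPt_iff_not_le_sq g I le_rfl hy.ge]
  intro hle
  have hI : stalkIdeal I y ≤ maximalIdeal (Y.presheaf.stalk y) ^ 2 :=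
    le_trans (stalkIdeal_mono (le_diffIdealSheaf (kStr g) (1 - 1) I) y) hle
  have h2 : ((2 : ℕ) : ℕ∞) ≤ idealOrder I y := (le_idealOrder_iff I y 2).mpr hI
  rw [hy] at h2
  exact absurd (by exact_mod_cast h2 : (2 : ℕ) ≤ 1) (by norm_num)

end Contact

section Transport

variable {k : Type} [Field k] {Y Y' : Scheme.{0}} (g : Y ⟶ Spec (.of k))

/-! ## §K.2  Transport of maximal contact off the centre of a blow-up -/

/-- **Maximal contact is transported off the centre.** If `π : Y' → Y` is the blow-up of `Y` in `C`
and `x' ∈ Y'` lies off `π⁻¹(V(C))`, then `π` is a local isomorphism at `x'` compatible with the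
`k`-structures, so `Diff^{≤ n-1}` of the controlled transform at `x'` is the image of
`Diff^{≤ n-1}(𝓘)_{π x'}` under `𝒪_{Y, π x'} ≅ 𝒪_{Y', x'}`; hence maximal contact at `π x'` gives
maximal contact at `x'`. [folklore] -/
theorem isContactPt_controlledTransform_of_not_mem [LocallyOfFiniteType g] {π : Y' ⟶ Y}
    {C : Y.IdealSheafData} (hπ : IsBlowup π C) [LocallyOfFiniteType (π ≫ g)]
    (I : Y.IdealSheafData) (n b : ℕ) {x : Y'} (hx : π x ∉ (C.support : Set Y))
    (h : IsContactPt g I n (π x)) :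
    IsContactPt (π ≫ g) (controlledTransform π C I b) n x := by
  rw [isContactPt_iff_exists_stalk] at h ⊢
  obtain ⟨z, hzJ, hz1, hz2⟩ := h
  -- `π` is an isomorphism near `x`
  haveI : IsIso (π ∣_ ⟨(C.support : Set Y)ᶜ, C.support.isClosed.isOpen_compl⟩) := hπ.isIso_compl
  haveI : IsIso (π.stalkMap x) :=
    isIso_stalkMap_of_isIso_morphismRestrict π ⟨(C.support : Set Y)ᶜ, C.support.isClosed.isOpen_compl⟩
      x hx
  have hft : HasFiniteTypeSections (kStr g) := hasFiniteTypeSections_of_locallyOfFiniteType k g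
  have hft' : HasFiniteTypeSections (kStr (π ≫ g)) :=
    hasFiniteTypeSections_of_locallyOfFiniteType k (π ≫ g)
  letI algY : Algebra k (Y.presheaf.stalk (π x)) := stalkAlgebra (kStr g) (π x)
  letI algY' : Algebra k (Y'.presheaf.stalk x) := stalkAlgebra (kStr (π ≫ g)) x
  -- the stalk isomorphism is a `k`-algebra isomorphism
  let e0 : Y.presheaf.stalk (π x) ≃+* Y'.presheaf.stalk x :=
    (asIso (π.stalkMap x)).commRingCatIsoToRingEquiv
  have he0 : ∀ w, e0 w = (π.stalkMap x).hom w := fun w => rfl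
  have hcomm : ∀ c : k, e0 (algebraMap k (Y.presheaf.stalk (π x)) c) =
      algebraMap k (Y'.presheaf.stalk x) c := by
    intro c
    rw [he0]
    change (π.stalkMap x).hom ((Y.presheaf.germ ⊤ (π x) trivial).hom (kStr g c)) =
      (Y'.presheaf.germ ⊤ x trivial).hom (kStr (π ≫ g) c)
    rw [Scheme.Hom.germ_stalkMap_apply]
    simp only [kStr, RingHom.coe_comp, Function.comp_apply, Scheme.Hom.comp_appTop, CommRingCat.hom_comp]
    rfl
  let e : Y.presheaf.stalk (π x) ≃ₐ[k] Y'.presheaf.stalk x := AlgEquiv.ofRingEquiv (f := e0) hcomm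
  have hmap : ∀ J : Ideal (Y.presheaf.stalk (π x)), J.map (π.stalkMap x).hom = J.map e := fun J => rfl
  -- `Diff^{≤ n-1}` of the controlled transform at `x` = image of `Diff^{≤ n-1}(𝓘)_{π x}`
  have key : stalkIdeal (diffIdealSheaf (kStr (π ≫ g)) (n - 1) (controlledTransform π C I b)) x =
      (stalkIdeal (diffIdealSheaf (kStr g) (n - 1) I) (π x)).map e := by
    rw [stalkIdeal_diffIdealSheaf hft', stalkIdeal_diffIdealSheaf hft,
      hπ.stalkIdeal_controlledTransform_of_not_mem I b hx, stalkIdeal_comap_eq_map_stalkMap, hmap,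
      diffIdeal_map_algEquiv e]
  have hm : (maximalIdeal (Y.presheaf.stalk (π x))).map e = maximalIdeal (Y'.presheaf.stalk x) :=
    map_ringEquiv_maximalIdeal e.toRingEquiv
  refine ⟨e z, ?_, ?_, ?_⟩
  · rw [key]; exact Ideal.mem_map_of_mem e hzJ
  · rw [← hm]; exact Ideal.mem_map_of_mem e hz1
  · intro h2
    apply hz2
    rw [← Ideal.comap_map_of_bijective e e.bijective (I := maximalIdeal _ ^ 2), Ideal.mem_comap,
      Ideal.map_pow, hm]
    exact h2

end Transport

section Port

variable {k : Type} [Field k] {Y : Scheme.{0}} {g : Y ⟶ Spec (.of k)} {hY : Scheme.IsRegular Y}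
  {I : Y.IdealSheafData} {n : ℕ}

/-! ## §K.3  The one-shot centre: all exit points at once -/

/-- The **exit locus** of `(𝓘, n)`: the top-locus points that are not of class `≥ 2`. -/
def exitLocus (g : Y ⟶ Spec (.of k)) (hY : Scheme.IsRegular Y) (I : Y.IdealSheafData) (n : ℕ) :
    Set Y :=
  {y | idealOrder I y = n ∧ ¬ ClassGE g hY I n 2 y}

/-- Under the located-cut hypothesis every point of the exit locus is an exit point. [folklore] -/
theorem isExitPt_of_mem_exitLocus
    (hcls : ∀ y : Y, idealOrder I y = n → ClassGE g hY I n 2 y ∨ IsExitPt I n y) {y : Y}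
    (hy : y ∈ exitLocus g hY I n) : IsExitPt I n y :=
  (hcls y hy.1).resolve_left hy.2

/-- **The exit locus is finite** on a noetherian `Y`: its points are isolated in the top locus,
hence it is a discrete noetherian subspace. [folklore] -/
theorem exitLocus_finite [IsNoetherian Y]
    (hcls : ∀ y : Y, idealOrder I y = n → ClassGE g hY I n 2 y ∨ IsExitPt I n y) :
    (exitLocus g hY I n).Finite := by
  set S := exitLocus g hY I n with hS
  haveI : DiscreteTopology S := by
    refine discreteTopology_iff_isOpen_singleton.mpr fun s => ?_
    obtain ⟨-, ⟨U, hsU, hU⟩, -⟩ := isExitPt_of_mem_exitLocus hcls s.2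
    have h1 : ({s} : Set S) = Subtype.val ⁻¹' (U : Set Y) := by
      ext t
      simp only [Set.mem_singleton_iff, Set.mem_preimage]
      constructor
      · rintro rfl; exact hsU
      · intro ht; exact Subtype.ext (hU t.1 ht t.2.1)
    rw [h1]
    exact U.2.preimage continuous_subtype_val
  haveI : Finite S := NoetherianSpace.finite
  exact S.toFinite

/-- **The exit locus is closed** (a finite union of closed points). [folklore] -/
theorem isClosed_exitLocus [IsNoetherian Y]
    (hcls : ∀ y : Y, idealOrder I y = n → ClassGE g hY I n 2 y ∨ IsExitPt I n y) :
    IsClosed (exitLocus g hY I n) := by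
  rw [← Set.biUnion_of_singleton (exitLocus g hY I n)]
  exact (exitLocus_finite hcls).isClosed_biUnion fun y hy => (isExitPt_of_mem_exitLocus hcls hy).1

/-- The **one-shot centre**: the reduced closed subscheme on the exit locus. -/
def exitCentre [IsNoetherian Y]
    (hcls : ∀ y : Y, idealOrder I y = n → ClassGE g hY I n 2 y ∨ IsExitPt I n y) :
    Y.IdealSheafData :=
  Scheme.IdealSheafData.vanishingIdeal ⟨exitLocus g hY I n, isClosed_exitLocus hcls⟩

variable [IsNoetherian Y]
  (hcls : ∀ y : Y, idealOrder I y = n → ClassGE g hY I n 2 y ∨ IsExitPt I n y)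

/-- `coe_support_exitCentre`: Auxiliary step of this node's calculus, VERBATIM from the lens file (see the module
docstring); the statement is its type. [folklore] -/
theorem coe_support_exitCentre :
    ((exitCentre hcls).support : Set Y) = exitLocus g hY I n :=
  coe_support_vanishingIdeal _

/-- At each of its points the stalk of the one-shot centre is the maximal ideal. [folklore] -/
theorem stalkIdeal_exitCentre {y : Y} (hy : y ∈ exitLocus g hY I n) :
    stalkIdeal (exitCentre hcls) y = maximalIdeal (Y.presheaf.stalk y) := by
  obtain ⟨hcl, ⟨U, hyU, hU⟩, -⟩ := isExitPt_of_mem_exitLocus hcls hy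
  have h1 : ((⟨exitLocus g hY I n, isClosed_exitLocus hcls⟩ : Closeds Y) : Set Y) ∩ (U : Set Y) =
      ((⟨{y}, hcl⟩ : Closeds Y) : Set Y) ∩ (U : Set Y) := by
    ext z
    simp only [Closeds.coe_mk, Set.mem_inter_iff, Set.mem_singleton_iff]
    constructor
    · rintro ⟨hz, hzU⟩; exact ⟨hU z hzU hz.1, hzU⟩
    · rintro ⟨rfl, hzU⟩; exact ⟨hy, hzU⟩
  rw [exitCentre, stalkIdeal_vanishingIdeal_congr U hyU h1]
  exact stalkIdeal_vanishingIdeal_singleton hcl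

/-- **The one-shot centre is a regular (reduced, zero-dimensional) subscheme.** [folklore] -/
theorem isRegular_exitCentre_subscheme : Scheme.IsRegular (exitCentre hcls).subscheme := by
  refine Scheme.isRegular_subscheme_of_forall _ fun y hy => ?_
  have hy' : y ∈ exitLocus g hY I n := by
    rw [← coe_support_exitCentre hcls]; exact hy
  rw [stalkIdeal_exitCentre hcls hy']
  letI := Ideal.Quotient.field (maximalIdeal (Y.presheaf.stalk y))
  infer_instance

end Port

section Step

variable {k : Type} [Field k] {Y Y' : Scheme.{0}} (g : Y ⟶ Spec (.of k))

/-! ## §K.4  Generic one-step lemmas (any centre): class transport off the centre, concatenation -/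

/-- **Class `≥ j` is transported off the centre of a blow-up** (any centre `C`, any control `b`):
maximal contact by `isContactPt_controlledTransform_of_not_mem` (§K.2), Hironaka's `τ` by the tree's
`IsBlowup.stalkTau_controlledTransform_of_not_mem`. Reusable by every later layer of the port. [folklore] -/
theorem classGE_controlledTransform_of_not_mem [LocallyOfFiniteType g] {π : Y' ⟶ Y}
    {C : Y.IdealSheafData} (hπ : IsBlowup π C) [LocallyOfFiniteType (π ≫ g)]
    (hY : Scheme.IsRegular Y) (hY' : Scheme.IsRegular Y') (I : Y.IdealSheafData) (n b j : ℕ) {x : Y'}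
    (hx : π x ∉ (C.support : Set Y)) (h : ClassGE g hY I n j (π x)) :
    ClassGE (π ≫ g) hY' (controlledTransform π C I b) n j x := by
  rcases h with h | h | ⟨hj, hτ⟩
  · exact Or.inl h
  · exact Or.inr (Or.inl (isContactPt_controlledTransform_of_not_mem g hπ I n b hx h))
  · refine Or.inr (Or.inr ⟨hj, ?_⟩)
    haveI : IsRegularLocalRing (Y.presheaf.stalk (π x)) := hY _
    haveI : IsRegularLocalRing (Y'.presheaf.stalk x) := hY' x
    change j ≤ stalkTau (controlledTransform π C I b) x n
    rw [hπ.stalkTau_controlledTransform_of_not_mem I b n hx]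
    exact hτ

omit [Field k] in
/-- **Concatenation** (any centre `C`): a weak resolution of the controlled transform
`(σ^c(𝓘), n)` on `Bl_C Y`, for a centre `C` inside `Supp(𝓘, n)` with `C.subscheme` regular, is a weak
resolution of `(𝓘, n)` by the sequence `C :: t₁` — `WeakResolution` ignores the boundary
(`ForcedTowerClasses.weakResolution_congr`). [folklore] -/
theorem weakResolution_cons {Y : Scheme.{0}} (C : Y.IdealSheafData) (I : Y.IdealSheafData) (n : ℕ)
    (hsupp : (C.support : Set Y) ⊆ (⟨I, [], n⟩ : MarkedIdeal Y).support)
    (hreg : Scheme.IsRegular C.subscheme) (t₁ : CentreSeq (blowup C))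
    (h : WeakResolution t₁ (⟨controlledTransform (blowup.π C) C I n, [], n⟩ : MarkedIdeal (blowup C))) :
    WeakResolution (CentreSeq.cons C t₁) (⟨I, [], n⟩ : MarkedIdeal Y) := by
  have hM : WeakResolution t₁ ((⟨I, [], n⟩ : MarkedIdeal Y).transform (blowup.π C) C) :=
    (ForcedTowerClasses.weakResolution_congr t₁
      (((⟨I, [], n⟩ : MarkedIdeal Y).transform (blowup.π C) C))
      ⟨controlledTransform (blowup.π C) C I n, [], n⟩ rfl rfl).mpr h
  refine ⟨?_, ?_⟩
  · simp only [WeakAdmissible]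
    exact ⟨hsupp, hreg, hM.1⟩
  · exact hM.2

end Step

end Summit.ResolutionOfSingularities.ResolutionOfSingularities.Theorems.ExitCut
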